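import Mathlib.Algebra.Polynomial.Div
import Mathlib.Algebra.Polynomial.Degree.Lemmas
import Mathlib.Algebra.BigOperators.Field
import Mathlib.Algebra.Order.BigOperators.Group.Finset
import Mathlib.Tactic.FieldSimp
import Mathlib.Tactic.Ring
import Mathlib.Tactic.NormNum
import Mathlib.Tactic.Linarith
import HarnessLib

/-!
# Partial fractions of `P(k) / ∏ⱼ (k + iⱼ)` with poles at `-i`, `i ∈ ℕ`

Topic `Literature/NumberTheory/Transcendental`. An elementary EXISTENCE theorem for the partial
fraction expansion of the rational functions of the hypergeometric constructions of linear forms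
in zeta values ([Zudilin2004, (2.15), (8.7) and the expansion in the proof of Lemma 19]:
`R(t) = ∑ⱼ ∑ₖ B_{jk}/(t+k)^{j-r}`): if `P` is a polynomial over a field `K` of characteristic
zero and `L` is a list of natural numbers (the shifts of the linear factors of the denominator,
with multiplicity) of length `> deg P`, then on the complement of the poles

  `P(k) / ∏_{i ∈ L} (k + i) = ∑_{i} ∑_{s=1}^{count i L} c_{i,s} (k + i)^{-s}`

for suitable constants `c_{i,s} ∈ K` (`exists_pfEval_eq_eval_mul_prod_inv`). The proof is the
division algorithm: dividing a polynomial by `k + i₀` lowers the degree and creates a simple pole;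
dividing `(k+i)^{-s}` by `k + i₀` creates `(k+i)^{-r}`, `r ≤ s`, and `(k+i₀)^{-1}`
(`exists_pow_inv_mul_inv`); the expansion is book-kept by the predicate `IsPF`. No uniqueness
statement is proved here (where needed, the coefficients are identified analytically, as divided
derivatives). Mathlib's `div_eq_quo_add_sum_rem_div` (`RatFunc`/`Polynomial.PartialFractions`)
is the coprime-factor version inside `K[X]`, not the evaluated pole-order form needed for the
arithmetic of the coefficients. Everything is PROVED (no named facts).

## References

* [Zudilin2004] W. Zudilin, *Arithmetic of linear forms involving odd zeta values*, J. Théor.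
  Nombres Bordeaux 16 (2004), 251–291, (2.15) and the proof of Lemma 19.
-/

noncomputable section

open Finset Polynomial

namespace Literature.NumberTheory.Transcendental

variable {K : Type*} [Field K]

/-! ### Partial-fraction sums -/

/-- The partial-fraction sum `∑_{i ∈ T} ∑_{s=1}^{m i} c i s · (k+i)^{-s}`. [folklore] -/
def pfEval (T : Finset ℕ) (m : ℕ → ℕ) (c : ℕ → ℕ → K) (k : K) : K :=
  ∑ i ∈ T, ∑ s ∈ Icc 1 (m i), c i s * ((k + i) ^ s)⁻¹

/-- `IsPF T m f`: away from the poles `-i`, `i ∈ T`, the function `f` is a partial-fraction sum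
with poles of order `≤ m i` at `-i` and no polynomial part. [folklore] -/
def IsPF (T : Finset ℕ) (m : ℕ → ℕ) (f : K → K) : Prop :=
  ∃ c : ℕ → ℕ → K, ∀ k : K, (∀ i ∈ T, k + i ≠ 0) → f k = pfEval T m c k

namespace IsPF

variable {T : Finset ℕ} {m m' : ℕ → ℕ} {f g : K → K}

/-- The zero function is a partial-fraction sum (all coefficients `0`). [folklore] -/
theorem zero (T : Finset ℕ) (m : ℕ → ℕ) : IsPF T m (fun _ : K => 0) :=
  ⟨fun _ _ => 0, fun k _ => by simp [pfEval]⟩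

/-- `IsPF` only depends on the values away from the poles. [folklore] -/
theorem congr (hf : IsPF T m f) (h : ∀ k : K, (∀ i ∈ T, k + i ≠ 0) → f k = g k) : IsPF T m g := by
  obtain ⟨c, hc⟩ := hf
  exact ⟨c, fun k hk => (h k hk).symm.trans (hc k hk)⟩

/-- Partial-fraction sums are closed under addition. [folklore] -/
theorem add (hf : IsPF T m f) (hg : IsPF T m g) : IsPF T m (fun k => f k + g k) := by
  obtain ⟨c, hc⟩ := hf
  obtain ⟨d, hd⟩ := hg
  refine ⟨fun i s => c i s + d i s, fun k hk => ?_⟩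
  beta_reduce
  rw [hc k hk, hd k hk, pfEval, pfEval, pfEval, ← sum_add_distrib]
  refine sum_congr rfl fun i _ => ?_
  rw [← sum_add_distrib]
  exact sum_congr rfl fun s _ => by ring

/-- Partial-fraction sums are closed under scalar multiplication. [folklore] -/
theorem smul (hf : IsPF T m f) (a : K) : IsPF T m (fun k => a * f k) := by
  obtain ⟨c, hc⟩ := hf
  refine ⟨fun i s => a * c i s, fun k hk => ?_⟩
  beta_reduce
  rw [hc k hk, pfEval, pfEval, mul_sum]
  refine sum_congr rfl fun i _ => ?_
  rw [mul_sum]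
  exact sum_congr rfl fun s _ => by ring

/-- Partial-fraction sums are closed under finite sums. [folklore] -/
theorem sum {ι : Type*} (S : Finset ι) {F : ι → K → K} (h : ∀ j ∈ S, IsPF T m (F j)) :
    IsPF T m (fun k => ∑ j ∈ S, F j k) := by
  classical
  induction S using Finset.induction_on with
  | empty => simpa using zero T m
  | insert a s ha ih =>
    have := (h a (mem_insert_self a s)).add (ih fun j hj => h j (mem_insert_of_mem hj))
    exact this.congr fun k _ => by rw [sum_insert ha]

/-- Raising the multiplicity bounds. [folklore] -/
theorem mono (hf : IsPF T m f) (hm : ∀ i ∈ T, m i ≤ m' i) : IsPF T m' f := by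
  classical
  obtain ⟨c, hc⟩ := hf
  refine ⟨fun i s => if s ≤ m i then c i s else 0, fun k hk => ?_⟩
  rw [hc k hk, pfEval, pfEval]
  refine sum_congr rfl fun i hi => ?_
  have hsub : Icc 1 (m i) ⊆ Icc 1 (m' i) := Icc_subset_Icc le_rfl (hm i hi)
  rw [← sum_subset hsub]
  · exact sum_congr rfl fun s hs => by rw [if_pos (mem_Icc.1 hs).2]
  · intro s hs hs'
    have : ¬ s ≤ m i := fun h => hs' (mem_Icc.2 ⟨(mem_Icc.1 hs).1, h⟩)
    rw [if_neg this, zero_mul]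

/-- A single term `a (k+i)^{-s}`, `i ∈ T`, `1 ≤ s ≤ m i`. [folklore] -/
theorem single {i s : ℕ} (hi : i ∈ T) (hs : 1 ≤ s) (hsm : s ≤ m i) (a : K) :
    IsPF T m (fun k : K => a * ((k + i) ^ s)⁻¹) := by
  classical
  refine ⟨fun i' s' => if i' = i ∧ s' = s then a else 0, fun k _ => ?_⟩
  beta_reduce
  rw [pfEval, sum_eq_single_of_mem i hi]
  · rw [sum_eq_single_of_mem s (mem_Icc.2 ⟨hs, hsm⟩)]
    · simp
    · intro s' _ hs'
      rw [if_neg (fun h => hs' h.2), zero_mul]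
  · intro i' _ hi'
    refine sum_eq_zero fun s' _ => ?_
    rw [if_neg (fun h => hi' h.1), zero_mul]

end IsPF

/-! ### Two poles -/

/-- `(k+i)^{-s} (k+i₀)^{-1}` (`i ≠ i₀`) is a combination of `(k+i)^{-r}`, `1 ≤ r ≤ s`, and
`(k+i₀)^{-1}` (induction on `s` from `1/((k+i)(k+i₀)) = (1/(i₀-i))(1/(k+i) - 1/(k+i₀))`).
[folklore] -/
theorem exists_pow_inv_mul_inv [CharZero K] (i i₀ : ℕ) (hne : i ≠ i₀) (s : ℕ) (hs : 1 ≤ s) :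
    ∃ (α : ℕ → K) (β : K), ∀ k : K, k + i ≠ 0 → k + i₀ ≠ 0 →
      ((k + i) ^ s)⁻¹ * (k + i₀)⁻¹ = ∑ r ∈ Icc 1 s, α r * ((k + i) ^ r)⁻¹ + β * (k + i₀)⁻¹ := by
  have hd : ((i₀ : K) - i) ≠ 0 := by
    intro h
    exact hne ((Nat.cast_injective (R := K)) (sub_eq_zero.1 h)).symm
  induction s, hs using Nat.le_induction with
  | base =>
    refine ⟨fun _ => ((i₀ : K) - i)⁻¹, -((i₀ : K) - i)⁻¹, fun k hk hk₀ => ?_⟩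
    simp only [Icc_self, sum_singleton, pow_one]
    field_simp
    ring
  | succ s hs ih =>
    obtain ⟨α, β, hαβ⟩ := ih
    refine ⟨fun r => (if 2 ≤ r then α (r - 1) else 0) + (if r = 1 then β * ((i₀ : K) - i)⁻¹ else 0),
      -β * ((i₀ : K) - i)⁻¹, fun k hk hk₀ => ?_⟩
    have h1 : ((k + i) ^ (s + 1))⁻¹ * (k + i₀)⁻¹ = (k + i)⁻¹ * (((k + i) ^ s)⁻¹ * (k + i₀)⁻¹) := by
      rw [pow_succ, mul_inv]; ring
    rw [h1, hαβ k hk hk₀, mul_add, mul_sum]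
    have h2 : (k + i)⁻¹ * (β * (k + i₀)⁻¹)
        = β * ((i₀ : K) - i)⁻¹ * ((k + i) ^ 1)⁻¹ + (-β * ((i₀ : K) - i)⁻¹) * (k + i₀)⁻¹ := by
      rw [pow_one]
      field_simp
      ring
    rw [h2, ← add_assoc]
    congr 1
    have hA : ∑ r ∈ Icc 1 s, (k + i)⁻¹ * (α r * ((k + i) ^ r)⁻¹)
        = ∑ r ∈ Icc 1 (s + 1), (if 2 ≤ r then α (r - 1) else 0) * ((k + i) ^ r)⁻¹ := by
      rw [show Icc 1 (s + 1) = insert 1 (Icc 2 (s + 1)) by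
        ext r; simp only [mem_insert, mem_Icc]; omega]
      rw [sum_insert (by simp), if_neg (by norm_num), zero_mul, zero_add]
      have hshift : Icc 2 (s + 1) = (Icc 1 s).map ⟨fun r => r + 1, fun a b h => by simpa using h⟩ := by
        ext r
        simp only [Finset.mem_map, Finset.mem_Icc, Function.Embedding.coeFn_mk]
        constructor
        · intro h; exact ⟨r - 1, by omega, by omega⟩
        · rintro ⟨r', h1, rfl⟩; omega
      rw [hshift, sum_map]
      refine sum_congr rfl fun r hr => ?_
      have hr' := (mem_Icc.1 hr).1
      simp only [Function.Embedding.coeFn_mk]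
      rw [if_pos (by omega), Nat.add_sub_cancel, pow_succ, mul_inv]
      ring
    have hB : ∑ r ∈ Icc 1 (s + 1), (if r = 1 then β * ((i₀ : K) - i)⁻¹ else 0) * ((k + i) ^ r)⁻¹
        = β * ((i₀ : K) - i)⁻¹ * ((k + i) ^ 1)⁻¹ := by
      rw [sum_eq_single_of_mem 1 (mem_Icc.2 ⟨le_rfl, by omega⟩)]
      · rw [if_pos rfl]
      · intro r _ hr; rw [if_neg hr, zero_mul]
    rw [sum_add_distrib.symm.trans (sum_congr rfl fun r _ => (add_mul _ _ _).symm) |>.symm, hA, hB]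

/-! ### Division by a linear factor -/

/-- Dividing a partial-fraction sum by `k + i₀`, `i₀ ∈ T`, gives a partial-fraction sum with the
multiplicity at `i₀` raised by one. [folklore] -/
theorem IsPF.mul_inv [CharZero K] {T : Finset ℕ} {m : ℕ → ℕ} {f : K → K} (hf : IsPF T m f) {i₀ : ℕ}
    (hi₀ : i₀ ∈ T) :
    IsPF T (fun i => m i + if i = i₀ then 1 else 0) (fun k => f k * (k + i₀)⁻¹) := by
  classical
  obtain ⟨c, hc⟩ := hf
  set m' : ℕ → ℕ := fun i => m i + if i = i₀ then 1 else 0 with hm'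
  -- each term of the expansion, divided by `k + i₀`, is a partial-fraction sum
  have hterm : ∀ i ∈ T, ∀ s ∈ Icc 1 (m i),
      IsPF T m' (fun k : K => c i s * ((k + i) ^ s)⁻¹ * (k + i₀)⁻¹) := by
    intro i hi s hs
    have hs1 := (mem_Icc.1 hs).1
    have hsm := (mem_Icc.1 hs).2
    by_cases hii : i = i₀
    · subst hii
      have h := IsPF.single (T := T) (m := m') (i := i) (s := s + 1) hi (by omega)
        (by simp [hm']; omega) (c i s)
      refine h.congr fun k _ => ?_
      rw [pow_succ, _root_.mul_inv]
      ring
    · obtain ⟨α, β, hαβ⟩ := exists_pow_inv_mul_inv (K := K) i i₀ hii s hs1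
      have hsum : IsPF T m' (fun k : K => c i s * (∑ r ∈ Icc 1 s, α r * ((k + i) ^ r)⁻¹
          + β * (k + i₀)⁻¹)) := by
        refine IsPF.smul (IsPF.add (IsPF.sum (Icc 1 s) fun r hr => ?_) ?_) (c i s)
        · exact IsPF.single hi (mem_Icc.1 hr).1 (by
            have := (mem_Icc.1 hr).2; simp only [hm']; (split_ifs; omega)) (α r)
        · have := IsPF.single (T := T) (m := m') (i := i₀) (s := 1) hi₀ le_rfl
            (by simp [hm']) β
          exact this.congr fun k _ => by rw [pow_one]
      refine hsum.congr fun k hk => ?_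
      rw [← hαβ k (hk i hi) (hk i₀ hi₀)]
      ring
  have hall := IsPF.sum T (m := m') fun i hi => IsPF.sum (Icc 1 (m i)) fun s hs => hterm i hi s hs
  refine hall.congr fun k hk => ?_
  rw [hc k hk, pfEval, sum_mul]
  refine sum_congr rfl fun i _ => ?_
  rw [sum_mul]

/-- Dividing a polynomial by `k + i₀`: `Q(k) = (k + i₀) Q₁(k) + Q(-i₀)` with
`Q₁ = Q /ₘ (X + i₀)`. [folklore] -/
theorem eval_eq_mul_divByMonic_add (Q : K[X]) (i₀ : ℕ) (k : K) :
    Q.eval k = (k + i₀) * (Q /ₘ (X + C (i₀ : K))).eval k + Q.eval (-(i₀ : K)) := by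
  have h := modByMonic_add_div Q (X + C (i₀ : K))
  have hmod : Q %ₘ (X + C (i₀ : K)) = C (Q.eval (-(i₀ : K))) := by
    rw [show (X + C (i₀ : K)) = X - C (-(i₀ : K)) by simp, modByMonic_X_sub_C_eq_C_eval]
  conv_lhs => rw [← h]
  rw [hmod, eval_add, eval_C, eval_mul, eval_add, eval_X, eval_C]
  ring

/-! ### The existence theorem -/

/-- **Existence of partial fractions** for `P(k) · ∏_{i ∈ L} (k + i)⁻¹`: there is a polynomial
`Q` with `Q = 0` or `deg Q + |L| ≤ deg P` such that `P ∏ (k+i)⁻¹ - Q` is a partial-fraction sum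
with poles of order `count i L` at `-i`. [folklore] -/
theorem exists_isPF_eval_mul_prod_inv_sub [CharZero K] (T : Finset ℕ) (P : K[X]) :
    ∀ L : List ℕ, (∀ i ∈ L, i ∈ T) → ∃ Q : K[X], (Q = 0 ∨ Q.natDegree + L.length ≤ P.natDegree) ∧
      IsPF T (fun i => L.count i)
        (fun k : K => P.eval k * (L.map fun i : ℕ => (k + (i : K))⁻¹).prod - Q.eval k) := by
  classical
  intro L
  induction L with
  | nil =>
    intro _
    exact ⟨P, Or.inr (by simp), (IsPF.zero T _).congr fun k _ => by simp⟩
  | cons i₀ L ih =>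
    intro hL
    have hi₀ : i₀ ∈ T := hL i₀ List.mem_cons_self
    obtain ⟨Q, hQdeg, hQ⟩ := ih fun i hi => hL i (List.mem_cons_of_mem _ hi)
    set Q₁ : K[X] := Q /ₘ (X + C (i₀ : K)) with hQ₁
    refine ⟨Q₁, ?_, ?_⟩
    · -- degree book-keeping
      have hmonic : (X + C (i₀ : K)).Monic := monic_X_add_C _
      rcases hQdeg with hQ0 | hQdeg
      · left; rw [hQ₁, hQ0, zero_divByMonic]
      · by_cases hQ0 : Q.natDegree = 0
        · left
          rw [hQ₁, divByMonic_eq_zero_iff hmonic]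
          exact degree_lt_degree (by rw [natDegree_X_add_C]; omega)
        · right
          have h1 : Q₁.natDegree = Q.natDegree - 1 := by
            rw [hQ₁, natDegree_divByMonic _ hmonic, natDegree_X_add_C]
          rw [h1, List.length_cons]
          omega
    · -- the expansion
      have h1 := hQ.mul_inv hi₀
      have h2 := IsPF.single (T := T) (m := fun i => (L.count i) + if i = i₀ then 1 else 0)
        (i := i₀) (s := 1) hi₀ le_rfl (by simp) (Q.eval (-(i₀ : K)))
      have h12 := h1.add h2
      have hm : ∀ i ∈ T, ((L.count i) + if i = i₀ then 1 else 0) ≤ (i₀ :: L).count i := by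
        intro i _
        rw [List.count_cons]
        by_cases h : i = i₀
        · subst h; simp
        · have hb : (i₀ == i) = false := beq_eq_false_iff_ne.2 (Ne.symm h)
          simp [hb, h]
      refine (h12.mono hm).congr fun k hk => ?_
      have hk₀ : k + i₀ ≠ 0 := hk i₀ hi₀
      rw [List.map_cons, List.prod_cons, eval_eq_mul_divByMonic_add Q i₀ k, ← hQ₁]
      rw [pow_one]
      field_simp
      ring

/-- **Partial fractions of `P(k)/∏_{i∈L}(k+i)` when `|L| > deg P`**: on the complement of the
poles, `P(k) ∏_{i ∈ L} (k+i)⁻¹ = ∑_{i ∈ T} ∑_{s=1}^{count i L} c_{i,s} (k+i)^{-s}` for suitable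
constants `c_{i,s}` (`T ⊇ L` any finite set of shifts). This is the shape of the expansions
(2.15), (8.7)ff of [Zudilin2004]. [folklore] -/
theorem exists_pfEval_eq_eval_mul_prod_inv [CharZero K] (T : Finset ℕ) (P : K[X]) (L : List ℕ)
    (hL : ∀ i ∈ L, i ∈ T) (hdeg : P.natDegree < L.length) :
    ∃ c : ℕ → ℕ → K, ∀ k : K, (∀ i ∈ T, k + i ≠ 0) →
      P.eval k * (L.map fun i : ℕ => (k + (i : K))⁻¹).prod = pfEval T (fun i => L.count i) c k := by
  obtain ⟨Q, hQ, c, hc⟩ := exists_isPF_eval_mul_prod_inv_sub T P L hL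
  have hQ0 : Q = 0 := by
    rcases hQ with h | h
    · exact h
    · exfalso; omega
  refine ⟨c, fun k hk => ?_⟩
  have := hc k hk
  simp only [hQ0, eval_zero, sub_zero] at this
  exact this

end Literature.NumberTheory.Transcendental
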